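import Literature.NumberTheory.EllipticCurves.HeightConductorBoundsModularity
import Literature.NumberTheory.EllipticCurves.PastenEigenSystemCountProofs
import Literature.NumberTheory.EllipticCurves.ModularCurveNewformDimension
import Literature.NumberTheory.EllipticCurves.NewformsLinearIndependenceProofs
import Literature.NumberTheory.EllipticCurves.NewformsHeckeStableProofs
import HarnessLib

/-!
# von Känel–Matschke (eq:martinbound): the number of newforms of level dividing `N` is at most
# `(ν + 1)/12` — PROVED over the tree

Topic `Literature/NumberTheory/EllipticCurves` (family `abc`, LADDER-ABC A1: the *modular method*).
A proofs-only companion (theorems only; NO definition, NO new named fact, nothing restated; D-0026)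
of `HeightConductorBoundsModularity.lean`, following

* R. von Känel, B. Matschke, *Solving `S`-unit, Mordell, Thue, Thue–Mahler and generalized
  Ramanujan–Nagell equations via Shimura–Taniyama conjecture*, arXiv:1605.06079 = Mem. AMS **286**
  (2023) no. 1419 [`VonkanelMatschke2023`], **§10.5.3, proof of Prop. 10.8 (ii), display
  (eq:martinbound)**: *"Martin obtained in [Martin 2005] an explicit formula for `m` in terms of `N`
  and `ν`. This formula implies the estimate `m ≤ ν/12 − 1/2 + 1/3 + 1/4 = (ν + 1)/12`."*

Here `m = newformCount N = Σ_{M ∣ N} dim_ℂ S₂^{new}(Γ₀(M))` and `ν = condNu N = N ∏_{p² ∣ N}(1 − p⁻²)`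
are the quantities of `HeightConductorBoundsModularity.lean` (vKM (10.x) `def:bb*`, Prop. 10.8 (ii)).

## The proof over the tree (Martin's formula replaced by the Atkin–Lehner count)

1. `dim_ℂ S₂^{new}(Γ₀(M)) = #newforms0(M)` (`finrank_newSubspace0_eq_natCard_newforms0`): the
   newforms are a basis of the new subspace — the tree's THEOREMS `linearIndependent_newforms0_holds`
   and `span_newforms0_holds` (Atkin–Lehner 1970, Thm. 5; Diamond–Shurman Thm. 5.8.3).
2. `m = Σ_{ab = N} μ(a) dim S₂(Γ₀(b))` (`newformCount_eq_moebius_sum`): the tree's Möbius inversion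
   of the Atkin–Lehner count `dim S_k(Γ₀(L)) = Σ_{M ∣ L} #newforms0(M) d(L/M)`
   (`sum_divisors_card_newforms0_eq_moebius_sum`, `PastenEigenSystemCountProofs.lean`).
3. `12 dim S₂(Γ₀(b)) = 12 + ψ(b) − 3ν₂(b) − 4ν₃(b) − 6ν_∞(b)` (`twelve_mul_finrank_cuspForm_two_eq_int`:
   the genus formula and `dim S₂(Γ₀(N)) = g(X₀(N))`, both THEOREMS of the tree).
4. The four Dirichlet convolutions with `μ` are multiplicative and are evaluated at prime powers
   (`moebius_conv_eq_prod`; prime-power values of `ψ, ν₂, ν₃, ν_∞` from `ModularCurveSturmProofs` and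
   `ModularCurveNewformDimension`): `(μ ⋆ ψ)(N) = ν(N)` exactly (`moebius_conv_gamma0Index_eq_condNu`),
   `|(μ ⋆ ν₂)(N)| ≤ 1`, `|(μ ⋆ ν₃)(N)| ≤ 1`, `(μ ⋆ ν_∞)(N) ≥ 1`, `(μ ⋆ 1)(N) = 0` (`N ≥ 2`).
   Hence `12 m ≤ ν + 3 + 4 − 6 = ν + 1` (`twelve_mul_newformCount_le`), which is Martin's
   `m ≤ ν/12 − 1/2 + 1/3 + 1/4` term by term.

No `abc` claim; typed ≠ endorsed. All theorems; axioms standard.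

## References

* R. von Känel, B. Matschke, arXiv:1605.06079 (2016) = Mem. AMS 286 (2023), §10.5.3 (eq:martinbound).
  [VonkanelMatschke2023]
* G. Martin, *Dimensions of the spaces of cusp forms and newforms on `Γ₀(N)` and `Γ₁(N)`*,
  J. Number Theory 112 (2005) 298–331, Thm. 1. [Martin2005NewformDimensions]
* A. O. L. Atkin, J. Lehner, *Hecke operators on `Γ₀(m)`*, Math. Ann. 185 (1970), Thm. 5. [AtkinLehner1970]
-/

noncomputable section

open scoped ArithmeticFunction.Moebius MatrixGroups

open ArithmeticFunction Finset CongruenceSubgroup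

namespace Literature.NumberTheory.EllipticCurves.ModularForms

/-! ### 1. `dim S_k^{new}(Γ₀(M)) = #newforms0(M)` and `m` as a Möbius sum -/

/-- **`dim_ℂ S_k^{new}(Γ₀(M)) = #newforms0(M)`**: the newforms are a basis of the new subspace
(`linearIndependent_newforms0_holds`, `span_newforms0_holds`; Atkin–Lehner 1970, Thm. 5).
[cite: AtkinLehner1970, Thm. 5] -/
theorem finrank_newSubspace0_eq_natCard_newforms0 (M : ℕ) [NeZero M] (k : ℤ) :
    Module.finrank ℂ (newSubspace0 M k) = Nat.card (newforms0 M k) := by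
  classical
  haveI : Fintype (newforms0 M k) := (finite_newforms0_holds M k).fintype
  have hli : LinearIndependent ℂ ((↑) : newforms0 M k → CuspForm (Gamma0 M) k) :=
    linearIndependent_newforms0_holds M k
  have hsp : Submodule.span ℂ (newforms0 M k) = newSubspace0 M k := span_newforms0_holds M k
  rw [← hsp, finrank_span_set_eq_card hli, Set.toFinset_card, Nat.card_eq_fintype_card]

/-- `m(N) = Σ_{M ∣ N} n(M)` for any `n` with `n(M) = #newforms0(M)` (`M ≥ 1`): vKM's "`m` the number of
newforms of level dividing `N`" ((10.x) `def:bb*`). [cite: VonkanelMatschke2023, §10.5.1 (def:bb*)] -/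
theorem newformCount_eq_sum_divisors (N : ℕ) (n : ℕ → ℕ)
    (hn : ∀ (M : ℕ) [NeZero M], n M = Nat.card ↥(newforms0 M 2)) :
    newformCount N = ∑ M ∈ N.divisors, n M := by
  unfold newformCount
  rw [← Finset.sum_coe_sort N.divisors n]
  refine Finset.sum_congr rfl fun M _ ↦ ?_
  haveI : NeZero (M : ℕ) := ⟨(Nat.pos_of_mem_divisors M.2).ne'⟩
  exact (finrank_newSubspace0_eq_natCard_newforms0 (M : ℕ) 2).trans (hn M).symm

/-- **`m = Σ_{ab = N} μ(a) · dim_ℂ S₂(Γ₀(b))`** (`N ≥ 1`): the number of newforms of level dividing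
`N` by Möbius inversion of the Atkin–Lehner count (`sum_divisors_card_newforms0_eq_moebius_sum`).
[cite: AtkinLehner1970, Thm. 5] -/
theorem newformCount_eq_moebius_sum {N : ℕ} (hN : N ≠ 0) :
    (newformCount N : ℤ) = ∑ x ∈ N.divisorsAntidiagonal,
      (μ x.1 : ℤ) * (Module.finrank ℂ (CuspForm (Gamma0 x.2) 2) : ℤ) := by
  classical
  let n : ℕ → ℕ := fun M ↦ if h : M = 0 then 0 else @Nat.card ↥(@newforms0 M ⟨h⟩ 2)
  have hn : ∀ (M : ℕ) [NeZero M], n M = Nat.card ↥(newforms0 M 2) := fun M _ ↦ by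
    simp only [n, dif_neg (NeZero.ne M)]
  rw [newformCount_eq_sum_divisors N n hn]
  exact sum_divisors_card_newforms0_eq_moebius_sum N hN 2 n hn

/-! ### 2. Möbius convolutions of multiplicative functions at prime powers -/

/-- For `f : ℕ → ℤ` multiplicative (`f(1) = 1`, `f(mn) = f(m) f(n)` for coprime `m, n ≥ 1`) and
`N ≥ 1`: `Σ_{ab = N} μ(a) f(b) = ∏_{p^e ∥ N} (f(p^e) − f(p^{e−1}))` — the Dirichlet convolution of
multiplicative functions is multiplicative and is read off at prime powers (the mechanism of Martin's
§2, "both sides are multiplicative … it suffices to check prime powers"; Hardy–Wright Thm. 265).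
[cite: Martin2005NewformDimensions, §2 (proof of Thm. 1: multiplicativity and prime powers)] -/
theorem moebius_conv_eq_prod {f : ℕ → ℤ} (h1 : f 1 = 1)
    (hmul : ∀ {m n : ℕ}, m ≠ 0 → n ≠ 0 → m.Coprime n → f (m * n) = f m * f n) {N : ℕ}
    (hN : N ≠ 0) :
    ∑ x ∈ N.divisorsAntidiagonal, (μ x.1 : ℤ) * f x.2 =
      ∏ p ∈ N.primeFactors, (f (p ^ N.factorization p) - f (p ^ (N.factorization p - 1))) := by
  classical
  let F : ArithmeticFunction ℤ := ⟨fun m ↦ if m = 0 then 0 else f m, if_pos rfl⟩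
  have hF : ∀ m : ℕ, m ≠ 0 → F m = f m := fun m hm ↦ if_neg hm
  have hFmult : F.IsMultiplicative := by
    refine IsMultiplicative.iff_ne_zero.mpr ⟨?_, fun {m n} hm hn hmn ↦ ?_⟩
    · rw [hF 1 one_ne_zero, h1]
    · rw [hF _ (mul_ne_zero hm hn), hF m hm, hF n hn, hmul hm hn hmn]
  have hmult : (μ * F).IsMultiplicative := isMultiplicative_moebius.mul hFmult
  have hsum : ∑ x ∈ N.divisorsAntidiagonal, (μ x.1 : ℤ) * f x.2 = (μ * F) N := by
    rw [mul_apply]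
    refine Finset.sum_congr rfl fun x hx ↦ ?_
    rw [hF x.2 (Nat.ne_zero_of_mem_divisorsAntidiagonal hx).2]
  have hpp : ∀ (p b : ℕ), p.Prime → (μ * F) (p ^ (b + 1)) = f (p ^ (b + 1)) - f (p ^ b) := by
    intro p b hp
    have hdiv : p ^ (b + 1) / p = p ^ b := by
      rw [pow_succ, Nat.mul_div_cancel _ hp.pos]
    rw [mul_apply, Nat.sum_divisorsAntidiagonal (fun i j ↦ (μ i : ℤ) * F j),
      Nat.sum_divisors_prime_pow hp, Finset.sum_range_succ', Finset.sum_range_succ']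
    have hrest : ∑ i ∈ Finset.range b,
        (μ (p ^ (i + 1 + 1)) : ℤ) * F (p ^ (b + 1) / p ^ (i + 1 + 1)) = 0 := by
      refine Finset.sum_eq_zero fun i _ ↦ ?_
      rw [moebius_apply_prime_pow hp (by omega), if_neg (by omega), zero_mul]
    rw [hrest, zero_add]
    simp only [zero_add, pow_zero, Nat.div_one, pow_one, moebius_apply_one, one_mul,
      moebius_apply_prime hp, hdiv]
    rw [hF _ (pow_ne_zero _ hp.ne_zero), hF _ (pow_ne_zero _ hp.ne_zero)]
    ring
  rw [hsum, hmult.multiplicative_factorization _ hN, Finsupp.prod, Nat.support_factorization]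
  refine Finset.prod_congr rfl fun p hp ↦ ?_
  have hpp' := Nat.prime_of_mem_primeFactors hp
  obtain ⟨b, hb⟩ := Nat.exists_eq_add_one_of_ne_zero
    (hpp'.factorization_pos_of_dvd hN (Nat.dvd_of_mem_primeFactors hp)).ne'
  rw [hb, Nat.add_sub_cancel]
  exact hpp p b hpp'

/-- `Σ_{ab = N} μ(a) = 0` for `N ≥ 2` (`Σ_{d ∣ n} μ(d) = 0` for `n > 1`, Hardy–Wright Thm. 263).
[cite: HardyWright2008, Thm 263 (§16.3)] -/
theorem moebius_conv_one_eq_zero {N : ℕ} (hN : 2 ≤ N) :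
    ∑ x ∈ N.divisorsAntidiagonal, (μ x.1 : ℤ) = 0 := by
  have h := moebius_conv_eq_prod (f := fun _ ↦ (1 : ℤ)) rfl (fun _ _ _ ↦ (mul_one _).symm)
    (N := N) (by omega)
  simp only [mul_one, sub_self] at h
  rw [h]
  obtain ⟨p, hp⟩ : N.primeFactors.Nonempty :=
    Nat.nonempty_primeFactors.mpr (by omega)
  exact Finset.prod_eq_zero hp rfl

/-! ### 3. The index: `(μ ⋆ ψ)(N) = ν(N)` exactly -/

/-- **`Σ_{ab = N} μ(a) ψ(b) = ν(N) = N ∏_{p² ∣ N}(1 − p⁻²)`** for `N ≥ 1`, `ψ = gamma0Index`: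
`(μ ⋆ ψ)(p) = p`, `(μ ⋆ ψ)(p^e) = p^{e−2}(p² − 1)` for `e ≥ 2` (vKM's `ν = N ν*(N)`, `ν*(p) = 1`,
`ν*(p^k) = 1 − p⁻²`; this is Martin's main term `Σ_{M ∣ N} M s₀⁺(M)`).
[cite: VonkanelMatschke2023, Prop. 10.8 (ii) and §10.5.3 (eq:martinbound)] -/
theorem moebius_conv_gamma0Index_eq_condNu {N : ℕ} (hN : N ≠ 0) :
    ((∑ x ∈ N.divisorsAntidiagonal, (μ x.1 : ℤ) * (gamma0Index x.2 : ℤ) : ℤ) : ℝ) = condNu N := by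
  have h := moebius_conv_eq_prod (f := fun n ↦ (gamma0Index n : ℤ))
    (by rw [gamma0Index_one]; rfl)
    (fun {m n} _ _ hmn ↦ by rw [gamma0Index_mul hmn, Nat.cast_mul]) hN
  rw [h]
  unfold condNu
  rw [Finset.prod_filter]
  have hNprod : (N : ℝ) = ∏ p ∈ N.primeFactors, (p : ℝ) ^ N.factorization p := by
    conv_lhs => rw [← Nat.prod_factorization_pow_eq_self hN]
    rw [Finsupp.prod, Nat.support_factorization, Nat.cast_prod]
    simp only [Nat.cast_pow]
  rw [hNprod, ← Finset.prod_mul_distrib, Int.cast_prod]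
  refine Finset.prod_congr rfl fun p hp ↦ ?_
  have hpp := Nat.prime_of_mem_primeFactors hp
  have hp0 : (p : ℝ) ≠ 0 := by exact_mod_cast hpp.ne_zero
  set e := N.factorization p with he
  have he1 : 1 ≤ e := hpp.factorization_pos_of_dvd hN (Nat.dvd_of_mem_primeFactors hp)
  have hdvd : p ^ 2 ∣ N ↔ 2 ≤ e := hpp.pow_dvd_iff_le_factorization hN
  rcases Nat.lt_or_ge e 2 with h1 | h2
  · -- `e = 1`: `ψ(p) − ψ(1) = p`
    have he' : e = 1 := by omega
    rw [if_neg (by rw [hdvd]; omega), he', pow_one, Nat.sub_self, pow_zero, gamma0Index_one]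
    have hψ : gamma0Index p = p + 1 := by
      have := gamma0Index_prime_pow hpp one_ne_zero
      rwa [pow_one, Nat.sub_self, pow_zero, one_mul] at this
    rw [hψ]
    push_cast
    ring
  · -- `e = c + 2`: `p^{c+1}(p+1) − p^c(p+1) = p^{c+2}(1 − p⁻²)`
    obtain ⟨c, hc⟩ : ∃ c, e = c + 2 := ⟨e - 2, by omega⟩
    rw [if_pos (hdvd.mpr h2), hc, gamma0Index_prime_pow hpp (by omega),
      show c + 2 - 1 = c + 1 by omega, gamma0Index_prime_pow hpp (by omega),
      Nat.add_sub_cancel]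
    push_cast
    field_simp
    ring

/-! ### 4. The elliptic points: `|(μ ⋆ ν₂)(N)| ≤ 1`, `|(μ ⋆ ν₃)(N)| ≤ 1` -/

/-- Local values of `μ ⋆ ν₂`: `|ν₂(p^{b+1}) − ν₂(p^b)| ≤ 1` (`ν₂(2) = ν₂(1) = 1`, `ν₂(2^e) = 0` for
`e ≥ 2`; `ν₂(p^e) = 1 + (−1/p)` for odd `p`, `e ≥ 1`). [cite: ShimuraIATAF1971, Prop. 1.43] -/
theorem abs_nu₂_prime_pow_sub_le {p : ℕ} (hp : p.Prime) (b : ℕ) :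
    |(nu₂ (p ^ (b + 1)) : ℤ) - nu₂ (p ^ b)| ≤ 1 := by
  haveI := Fact.mk hp
  have h1 : nu₂ 1 = 1 := nu₂_one_and_nu₃_one.1
  rcases eq_or_ne p 2 with rfl | hp2
  · rcases Nat.eq_zero_or_pos b with rfl | hb
    · rw [pow_one, pow_zero, nu₂_two, h1]; simp
    · rw [nu₂_eq_zero_of_four_dvd (by
          rw [show (4 : ℕ) = 2 ^ 2 by norm_num]; exact pow_dvd_pow 2 (by omega))]
      rcases Nat.lt_or_ge b 2 with hb1 | hb2
      · have : b = 1 := by omega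
        subst this
        rw [pow_one, nu₂_two]; simp
      · rw [nu₂_eq_zero_of_four_dvd (by
            rw [show (4 : ℕ) = 2 ^ 2 by norm_num]; exact pow_dvd_pow 2 hb2)]
        simp
  · rw [nu₂_prime_pow hp2 (Nat.add_one_ne_zero b)]
    rcases Nat.eq_zero_or_pos b with rfl | hb
    · rw [pow_zero, h1]; split_ifs <;> simp
    · rw [nu₂_prime_pow hp2 hb.ne']; split_ifs <;> simp

/-- Local values of `μ ⋆ ν₃`: `|ν₃(p^{b+1}) − ν₃(p^b)| ≤ 1` (`ν₃(3) = ν₃(1) = 1`, `ν₃(3^e) = 0` for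
`e ≥ 2`; `ν₃(p^e) = 1 + (−3/p)` for `p ≠ 3`, `e ≥ 1`). [cite: ShimuraIATAF1971, Prop. 1.43] -/
theorem abs_nu₃_prime_pow_sub_le {p : ℕ} (hp : p.Prime) (b : ℕ) :
    |(nu₃ (p ^ (b + 1)) : ℤ) - nu₃ (p ^ b)| ≤ 1 := by
  haveI := Fact.mk hp
  have h1 : nu₃ 1 = 1 := nu₂_one_and_nu₃_one.2
  rcases eq_or_ne p 3 with rfl | hp3
  · rcases Nat.eq_zero_or_pos b with rfl | hb
    · rw [pow_one, pow_zero, nu₃_three, h1]; simp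
    · rw [nu₃_eq_zero_of_nine_dvd (by
          rw [show (9 : ℕ) = 3 ^ 2 by norm_num]; exact pow_dvd_pow 3 (by omega))]
      rcases Nat.lt_or_ge b 2 with hb1 | hb2
      · have : b = 1 := by omega
        subst this
        rw [pow_one, nu₃_three]; simp
      · rw [nu₃_eq_zero_of_nine_dvd (by
            rw [show (9 : ℕ) = 3 ^ 2 by norm_num]; exact pow_dvd_pow 3 hb2)]
        simp
  · rw [nu₃_prime_pow hp3 (Nat.add_one_ne_zero b)]
    rcases Nat.eq_zero_or_pos b with rfl | hb
    · rw [pow_zero, h1]; split_ifs <;> simp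
    · rw [nu₃_prime_pow hp3 hb.ne']; split_ifs <;> simp

/-- **`|Σ_{ab = N} μ(a) ν₂(b)| ≤ 1`** (`N ≥ 1`): the convolution is multiplicative with local values
in `{−1, 0, 1}` (Martin's term `c₂(2) ν₂⁺`, contributing `≤ 1/4` to `m`).
[cite: VonkanelMatschke2023, §10.5.3 (eq:martinbound)] -/
theorem abs_moebius_conv_nu₂_le {N : ℕ} (hN : N ≠ 0) :
    |∑ x ∈ N.divisorsAntidiagonal, (μ x.1 : ℤ) * (nu₂ x.2 : ℤ)| ≤ 1 := by
  rw [moebius_conv_eq_prod (f := fun n ↦ (nu₂ n : ℤ)) (by exact_mod_cast nu₂_one_and_nu₃_one.1)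
    (fun {m n} _ _ hmn ↦ by rw [nu₂_mul_of_coprime hmn, Nat.cast_mul]) hN, Finset.abs_prod]
  refine Finset.prod_le_one (fun p _ ↦ abs_nonneg _) fun p hp ↦ ?_
  have hpp := Nat.prime_of_mem_primeFactors hp
  obtain ⟨b, hb⟩ := Nat.exists_eq_add_one_of_ne_zero
    (hpp.factorization_pos_of_dvd hN (Nat.dvd_of_mem_primeFactors hp)).ne'
  rw [hb, Nat.add_sub_cancel]
  exact abs_nu₂_prime_pow_sub_le hpp b

/-- **`|Σ_{ab = N} μ(a) ν₃(b)| ≤ 1`** (`N ≥ 1`) (Martin's term `c₃(2) ν₃⁺`, contributing `≤ 1/3`).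
[cite: VonkanelMatschke2023, §10.5.3 (eq:martinbound)] -/
theorem abs_moebius_conv_nu₃_le {N : ℕ} (hN : N ≠ 0) :
    |∑ x ∈ N.divisorsAntidiagonal, (μ x.1 : ℤ) * (nu₃ x.2 : ℤ)| ≤ 1 := by
  rw [moebius_conv_eq_prod (f := fun n ↦ (nu₃ n : ℤ)) (by exact_mod_cast nu₂_one_and_nu₃_one.2)
    (fun {m n} _ _ hmn ↦ by rw [nu₃_mul_of_coprime hmn, Nat.cast_mul]) hN, Finset.abs_prod]
  refine Finset.prod_le_one (fun p _ ↦ abs_nonneg _) fun p hp ↦ ?_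
  have hpp := Nat.prime_of_mem_primeFactors hp
  obtain ⟨b, hb⟩ := Nat.exists_eq_add_one_of_ne_zero
    (hpp.factorization_pos_of_dvd hN (Nat.dvd_of_mem_primeFactors hp)).ne'
  rw [hb, Nat.add_sub_cancel]
  exact abs_nu₃_prime_pow_sub_le hpp b

/-! ### 5. The cusps: `(μ ⋆ ν_∞)(N) ≥ 1` -/

/-- `ν_∞(1) = 1`. [cite: ShimuraIATAF1971, Prop. 1.43] -/
theorem nuInfty_one : nuInfty 1 = 1 := by
  simp [nuInfty]

/-- Local values of `μ ⋆ ν_∞`: `ν_∞(p^{b+1}) − ν_∞(p^b) ≥ 1` (`ν_∞(p^{2j+1}) = 2p^j`,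
`ν_∞(p^{2j+2}) = p^j(p+1)`: the differences are `1`, `p^j(p − 1)`). [cite: ShimuraIATAF1971, Prop. 1.43] -/
theorem one_le_nuInfty_prime_pow_sub {p : ℕ} (hp : p.Prime) (b : ℕ) :
    1 ≤ (nuInfty (p ^ (b + 1)) : ℤ) - nuInfty (p ^ b) := by
  have hp2 : (2 : ℤ) ≤ p := by exact_mod_cast hp.two_le
  obtain ⟨j, rfl | rfl⟩ := Nat.even_or_odd' b
  · -- `b = 2j`: `ν_∞(p^{2j+1}) − ν_∞(p^{2j})`
    rw [(nuInfty_prime_pow hp j).1]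
    rcases Nat.eq_zero_or_pos j with rfl | hj
    · rw [mul_zero, pow_zero, nuInfty_one]; norm_num
    · obtain ⟨i, rfl⟩ := Nat.exists_eq_add_one_of_ne_zero hj.ne'
      rw [show 2 * (i + 1) = 2 * i + 2 by ring, (nuInfty_prime_pow hp i).2]
      push_cast
      have hpi : (1 : ℤ) ≤ (p : ℤ) ^ i := one_le_pow₀ (by linarith)
      have key : (2 : ℤ) * (p : ℤ) ^ (i + 1) - (p : ℤ) ^ i * ((p : ℤ) + 1) =
          (p : ℤ) ^ i * ((p : ℤ) - 1) := by ring
      rw [key]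
      exact one_le_mul_of_one_le_of_one_le hpi (by linarith)
  · -- `b = 2j + 1`: `ν_∞(p^{2j+2}) − ν_∞(p^{2j+1})`
    rw [show 2 * j + 1 + 1 = 2 * j + 2 by ring, (nuInfty_prime_pow hp j).2,
      (nuInfty_prime_pow hp j).1]
    push_cast
    have hpj : (1 : ℤ) ≤ (p : ℤ) ^ j := one_le_pow₀ (by linarith)
    have key : (p : ℤ) ^ j * ((p : ℤ) + 1) - 2 * (p : ℤ) ^ j = (p : ℤ) ^ j * ((p : ℤ) - 1) := by ring
    rw [key]
    exact one_le_mul_of_one_le_of_one_le hpj (by linarith)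

/-- **`Σ_{ab = N} μ(a) ν_∞(b) ≥ 1`** (`N ≥ 1`) (Martin's term `−½ ν_∞⁺`, contributing `≤ −1/2`).
[cite: VonkanelMatschke2023, §10.5.3 (eq:martinbound)] -/
theorem one_le_moebius_conv_nuInfty {N : ℕ} (hN : N ≠ 0) :
    1 ≤ ∑ x ∈ N.divisorsAntidiagonal, (μ x.1 : ℤ) * (nuInfty x.2 : ℤ) := by
  rw [moebius_conv_eq_prod (f := fun n ↦ (nuInfty n : ℤ)) (by exact_mod_cast nuInfty_one)
    (fun {m n} _ _ hmn ↦ by rw [nuInfty_mul_of_coprime hmn, Nat.cast_mul]) hN]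
  rw [← Finset.prod_const_one (s := N.primeFactors)]
  refine Finset.prod_le_prod (fun _ _ ↦ zero_le_one) fun p hp ↦ ?_
  have hpp := Nat.prime_of_mem_primeFactors hp
  obtain ⟨b, hb⟩ := Nat.exists_eq_add_one_of_ne_zero
    (hpp.factorization_pos_of_dvd hN (Nat.dvd_of_mem_primeFactors hp)).ne'
  rw [hb, Nat.add_sub_cancel]
  exact one_le_nuInfty_prime_pow_sub hpp b

/-! ### 6. (eq:martinbound): `12 m ≤ ν + 1` -/

/-- **`12 m = ν − 3(μ ⋆ ν₂)(N) − 4(μ ⋆ ν₃)(N) − 6(μ ⋆ ν_∞)(N)`** for `N ≥ 2` (the genus formula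
summed against `μ`; Martin's Theorem 1 at `k = 2` summed over the divisors of `N`).
[cite: Martin2005NewformDimensions, Thm. 1] -/
theorem twelve_mul_newformCount_eq {N : ℕ} (hN : 2 ≤ N) :
    12 * (newformCount N : ℝ) = condNu N
      - 3 * ((∑ x ∈ N.divisorsAntidiagonal, (μ x.1 : ℤ) * (nu₂ x.2 : ℤ) : ℤ) : ℝ)
      - 4 * ((∑ x ∈ N.divisorsAntidiagonal, (μ x.1 : ℤ) * (nu₃ x.2 : ℤ) : ℤ) : ℝ)
      - 6 * ((∑ x ∈ N.divisorsAntidiagonal, (μ x.1 : ℤ) * (nuInfty x.2 : ℤ) : ℤ) : ℝ) := by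
  have hN0 : N ≠ 0 := by omega
  have hZ : 12 * (newformCount N : ℤ) =
      ∑ x ∈ N.divisorsAntidiagonal, (μ x.1 : ℤ) * (gamma0Index x.2 : ℤ)
      + 12 * ∑ x ∈ N.divisorsAntidiagonal, (μ x.1 : ℤ)
      - 3 * ∑ x ∈ N.divisorsAntidiagonal, (μ x.1 : ℤ) * (nu₂ x.2 : ℤ)
      - 4 * ∑ x ∈ N.divisorsAntidiagonal, (μ x.1 : ℤ) * (nu₃ x.2 : ℤ)
      - 6 * ∑ x ∈ N.divisorsAntidiagonal, (μ x.1 : ℤ) * (nuInfty x.2 : ℤ) := by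
    rw [newformCount_eq_moebius_sum hN0, Finset.mul_sum, Finset.mul_sum, Finset.mul_sum,
      Finset.mul_sum, Finset.mul_sum, ← Finset.sum_add_distrib, ← Finset.sum_sub_distrib,
      ← Finset.sum_sub_distrib, ← Finset.sum_sub_distrib]
    refine Finset.sum_congr rfl fun x hx ↦ ?_
    haveI : NeZero x.2 := ⟨(Nat.ne_zero_of_mem_divisorsAntidiagonal hx).2⟩
    have h := twelve_mul_finrank_cuspForm_two_eq_int x.2
    linear_combination (μ x.1 : ℤ) * h
  rw [moebius_conv_one_eq_zero hN, mul_zero, add_zero] at hZ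
  have hR : (12 : ℝ) * (newformCount N : ℝ) = ((12 * (newformCount N : ℤ) : ℤ) : ℝ) := by
    push_cast; ring
  rw [hR, hZ]
  push_cast
  rw [← moebius_conv_gamma0Index_eq_condNu hN0]
  push_cast
  ring

/-- **vKM (eq:martinbound): `12 m ≤ ν + 1`**, i.e. `m ≤ (ν + 1)/12`, for every `N ≥ 2` — PROVED
(Martin's `m ≤ ν/12 − 1/2 + 1/3 + 1/4`: the three correction terms are `−6(μ⋆ν_∞) ≤ −6`,
`−4(μ⋆ν₃) ≤ 4`, `−3(μ⋆ν₂) ≤ 3`). [cite: VonkanelMatschke2023, §10.5.3 (eq:martinbound)] -/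
theorem twelve_mul_newformCount_le {N : ℕ} (hN : 2 ≤ N) :
    12 * (newformCount N : ℝ) ≤ condNu N + 1 := by
  have hN0 : N ≠ 0 := by omega
  rw [twelve_mul_newformCount_eq hN]
  have h2 := abs_le.mp (abs_moebius_conv_nu₂_le hN0)
  have h3 := abs_le.mp (abs_moebius_conv_nu₃_le hN0)
  have hi := one_le_moebius_conv_nuInfty hN0
  have h2' : (-1 : ℝ) ≤ ((∑ x ∈ N.divisorsAntidiagonal, (μ x.1 : ℤ) * (nu₂ x.2 : ℤ) : ℤ) : ℝ) := by
    exact_mod_cast h2.1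
  have h3' : (-1 : ℝ) ≤ ((∑ x ∈ N.divisorsAntidiagonal, (μ x.1 : ℤ) * (nu₃ x.2 : ℤ) : ℤ) : ℝ) := by
    exact_mod_cast h3.1
  have hi' : (1 : ℝ) ≤ ((∑ x ∈ N.divisorsAntidiagonal, (μ x.1 : ℤ) * (nuInfty x.2 : ℤ) : ℤ) : ℝ) := by
    exact_mod_cast hi
  linarith

/-- **vKM (eq:martinbound), as printed: `m ≤ (ν + 1)/12`** (`N ≥ 2`).
[cite: VonkanelMatschke2023, §10.5.3 (eq:martinbound)] -/
theorem newformCount_le {N : ℕ} (hN : 2 ≤ N) :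
    (newformCount N : ℝ) ≤ (condNu N + 1) / 12 := by
  have := twelve_mul_newformCount_le hN
  rw [le_div_iff₀ (by norm_num)]
  linarith

end Literature.NumberTheory.EllipticCurves.ModularForms

end
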